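import Literature.NumberTheory.EllipticCurves.Sprung2017.HalfLogarithmMatrixDerivativeProofs
import Mathlib.RingTheory.PowerSeries.Substitution
import HarnessLib

/-!
# Sprung 2017 at `(p, a_p) = (3, ±3)`: the ROW TWISTS of the α-free half-logarithm matrix under
# `T ↦ (1+T)⁻¹ − 1` do not vanish — `coeff_T (ℒ_{r0}·ι(ℒ_{r1}) − ℒ_{r1}·ι(ℒ_{r0})) = ±1/21, ±3/7 ≠ 0`
# (proofs only)

`Proofs` file (theorems only) in the cluster `Sprung2017`, sequel of `HalfLogarithmMatrixDerivativeProofs.lean`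
(`ℒ(0) = C^{−2}`, `ℒ′(0)` explicit). For a power series `ι ∈ ℚ_3⟦T⟧` with `(1 + T)(ι + 1) = 1` (the
Iwasawa involution `T ↦ (1+T)⁻¹ − 1 = −T + T² − ⋯` of the functional equation, Mazur–Tate–Teitelbaum
§I.17 / Sprung 2017 Thm. 4.13) and each row `r ∈ {♯, ♭} = {0, 1}` of `ℒ = halfLogMatrix b` (`b = ±1`,
`a_3 = 3b`), the ROW TWIST `D_r := ℒ_{r0}·ℒ_{r1}(ι) − ℒ_{r1}·ℒ_{r0}(ι)` has
`coeff_T D_r = 2(ℒ′_{r0}(0)ℒ_{r1}(0) − ℒ_{r0}(0)ℒ′_{r1}(0))` — twice the Wronskian of the row at `T = 0`,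
since `ι` acts by `−1` on tangent vectors at its fixed point `T = 0` — and this is `1/21` (`r = ♯`),
`3/7` (`r = ♭`) at `a_3 = 3`, resp. `−1/21`, `−3/7` at `a_3 = −3`: **non-zero**
(`coeff_one_rowTwist_halfLogMatrix`, `coeff_one_rowTwist_halfLogMatrix_ne_zero`). Meaning: the completed /
non-completed ♯/♭ bases of Sprung 2017 (Cor. 4.6, `V = Log·L̂og⁻¹`) are COLOUR-MIXING to first order at
`T = 0` when `a_p ≠ 0` — at `a_p = 0` the twists vanish identically (both rows projectively `ι`-invariant,
Pollack's `log^±`). HONEST FRAMING: exact arithmetic; nothing about any curve; BSD is not proved by any of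
this. Consumer: stub S0 (both colours `L♯, L♭ ≠ 0` on class X8) of the crux line `chromatic-common-zeros`
(stmt-BirchSwinnertonDyer-19875), via the trace-coordinate functional equation.
-/

noncomputable section

open Polynomial Finset PowerSeries

namespace Literature.NumberTheory.EllipticCurves.Sprung2017

/-! ## §1 The involution `ι`: `ι(0) = 0`, `ι′(0) = −1`, and the first two coefficients of `f(ι)` -/

section Involution

variable {R : Type*} [CommRing R] {ι : R⟦X⟧}

/-- `(1 + T)(ι + 1) = 1` forces `ι(0) = 0`. [folklore] -/
private theorem constantCoeff_eq_zero_of_one_add_X_mul (hι : (1 + PowerSeries.X) * (ι + 1) = 1) :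
    PowerSeries.constantCoeff ι = 0 := by
  have h := congrArg PowerSeries.constantCoeff hι
  simp only [map_mul, map_add, map_one, PowerSeries.constantCoeff_X, add_zero, one_mul] at h
  linear_combination h

/-- `(1 + T)(ι + 1) = 1` forces `ι′(0) = −1` (`ι = −T + T² − ⋯`). [folklore] -/
private theorem coeff_one_eq_neg_one_of_one_add_X_mul (hι : (1 + PowerSeries.X) * (ι + 1) = 1) :
    PowerSeries.coeff 1 ι = -1 := by
  have h0 := constantCoeff_eq_zero_of_one_add_X_mul hι
  have h := congrArg (PowerSeries.coeff 1) hι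
  rw [PowerSeries.coeff_mul, Finset.Nat.sum_antidiagonal_succ, Finset.Nat.antidiagonal_zero,
    Finset.sum_singleton] at h
  simp [h0] at h
  linear_combination h

/-- For `g` with `g(0) = 0`: `(f(g))(0) = f(0)`. [folklore] -/
private theorem coeff_zero_subst_of_constantCoeff_eq_zero {g : R⟦X⟧} (hg : PowerSeries.constantCoeff g = 0)
    (f : R⟦X⟧) : PowerSeries.coeff 0 (f.subst g) = PowerSeries.coeff 0 f := by
  rw [PowerSeries.coeff_subst' (PowerSeries.HasSubst.of_constantCoeff_zero' hg), finsum_eq_single _ 0]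
  · simp
  · intro d hd
    rw [PowerSeries.coeff_zero_eq_constantCoeff_apply, map_pow, hg, zero_pow hd, smul_zero]

/-- For `g` with `g(0) = 0`: `coeff_T (f(g)) = coeff_T f · g′(0)` (the chain rule to first order).
[folklore] -/
private theorem coeff_one_subst_of_constantCoeff_eq_zero {g : R⟦X⟧} (hg : PowerSeries.constantCoeff g = 0)
    (f : R⟦X⟧) : PowerSeries.coeff 1 (f.subst g) = PowerSeries.coeff 1 f * PowerSeries.coeff 1 g := by
  rw [PowerSeries.coeff_subst' (PowerSeries.HasSubst.of_constantCoeff_zero' hg), finsum_eq_single _ 1]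
  · rw [pow_one, smul_eq_mul]
  · intro d hd
    rcases d with _ | _ | d
    · simp
    · exact absurd rfl hd
    · -- `g = X · h`, so `g^{d+2} = X^{d+2} h^{d+2}` has no linear term
      have hgX : g = PowerSeries.X * PowerSeries.mk fun n => PowerSeries.coeff (n + 1) g := by
        conv_lhs => rw [PowerSeries.eq_X_mul_shift_add_const g, hg, map_zero, add_zero]
      rw [hgX, mul_pow, PowerSeries.coeff_X_pow_mul', if_neg (by omega), smul_zero]

end Involution

/-! ## §2 The row twists of `ℒ(3, ±3)` have non-zero linear coefficient -/

section Twist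

variable {b : ℤ} {ι : PowerSeries ℚ_[3]}

/-- **The linear coefficient of a row twist**: for `ι` with `(1+T)(ι+1) = 1` and any four power series
with known constant and linear coefficients, `coeff_T (f·g(ι) − g·f(ι)) = 2(f₁g₀ − f₀g₁)`. [folklore] -/
private theorem coeff_one_twist (hι : (1 + PowerSeries.X) * (ι + 1) = 1) (f g : PowerSeries ℚ_[3]) :
    PowerSeries.coeff 1 (f * g.subst ι - g * f.subst ι) =
      2 * (PowerSeries.coeff 1 f * PowerSeries.coeff 0 g - PowerSeries.coeff 0 f * PowerSeries.coeff 1 g) := by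
  have h0 := constantCoeff_eq_zero_of_one_add_X_mul hι
  have h1 := coeff_one_eq_neg_one_of_one_add_X_mul hι
  rw [map_sub, PowerSeries.coeff_mul, PowerSeries.coeff_mul, Finset.Nat.sum_antidiagonal_succ,
    Finset.Nat.antidiagonal_zero, Finset.sum_singleton, Finset.Nat.sum_antidiagonal_succ,
    Finset.Nat.antidiagonal_zero, Finset.sum_singleton]
  simp only [coeff_zero_subst_of_constantCoeff_eq_zero h0, coeff_one_subst_of_constantCoeff_eq_zero h0, h1]
  ring

/-- **`coeff_T` of the `♯`-row twist and of the `♭`-row twist of `ℒ(3, 3)`**: `1/21` and `3/7`.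
[cite: Sprung2017, §3.1 and Cor. 4.6 (the bases differ by V = Log·L̂og⁻¹; here its first-order colour mixing at T = 0)] -/
theorem coeff_one_rowTwist_halfLogMatrix_one (hι : (1 + PowerSeries.X) * (ι + 1) = 1) (r : Fin 2) :
    PowerSeries.coeff 1 (halfLogMatrix 1 r 0 * (halfLogMatrix 1 r 1).subst ι -
        halfLogMatrix 1 r 1 * (halfLogMatrix 1 r 0).subst ι) =
      (((![1 / 21, 3 / 7] : Fin 2 → ℚ) r : ℚ) : ℚ_[3]) := by
  rw [coeff_one_twist hι, coeff_one_halfLogMatrix_one, coeff_one_halfLogMatrix_one,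
    coeff_zero_halfLogMatrix_one, coeff_zero_halfLogMatrix_one]
  fin_cases r <;> push_cast <;> norm_num

/-- **`coeff_T` of the row twists of `ℒ(3, −3)`**: `−1/21` and `−3/7`. [cite: Sprung2017, §3.1 and Cor. 4.6] -/
theorem coeff_one_rowTwist_halfLogMatrix_neg_one (hι : (1 + PowerSeries.X) * (ι + 1) = 1) (r : Fin 2) :
    PowerSeries.coeff 1 (halfLogMatrix (-1) r 0 * (halfLogMatrix (-1) r 1).subst ι -
        halfLogMatrix (-1) r 1 * (halfLogMatrix (-1) r 0).subst ι) =
      (((![-1 / 21, -3 / 7] : Fin 2 → ℚ) r : ℚ) : ℚ_[3]) := by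
  rw [coeff_one_twist hι, coeff_one_halfLogMatrix_neg_one, coeff_one_halfLogMatrix_neg_one,
    coeff_zero_halfLogMatrix_neg_one, coeff_zero_halfLogMatrix_neg_one]
  fin_cases r <;> push_cast <;> norm_num

/-- **Non-vanishing of both row twists at `a_3 = ±3`**: for `b = ±1`, `ι` the involution and each row `r`
(`♯` or `♭`), the row twist `ℒ_{r0}·ℒ_{r1}(ι) − ℒ_{r1}·ℒ_{r0}(ι)` of `ℒ(3, 3b)` has non-zero `T`-coefficient,
hence is NON-ZERO. (At `a_p = 0` it would vanish identically.) [cite: Sprung2017, Cor. 4.6 and Cor. 4.14 (the completed vs. non-completed ♯/♭ pairs)] -/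
theorem rowTwist_halfLogMatrix_ne_zero (hb : b = 1 ∨ b = -1) (hι : (1 + PowerSeries.X) * (ι + 1) = 1)
    (r : Fin 2) :
    halfLogMatrix b r 0 * (halfLogMatrix b r 1).subst ι - halfLogMatrix b r 1 * (halfLogMatrix b r 0).subst ι ≠ 0 := by
  intro h
  have h1 := congrArg (PowerSeries.coeff 1) h
  rw [map_zero] at h1
  rcases hb with rfl | rfl
  · rw [coeff_one_rowTwist_halfLogMatrix_one hι, Rat.cast_eq_zero] at h1
    fin_cases r <;> norm_num at h1
  · rw [coeff_one_rowTwist_halfLogMatrix_neg_one hι, Rat.cast_eq_zero] at h1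
    fin_cases r <;> norm_num at h1

end Twist

end Literature.NumberTheory.EllipticCurves.Sprung2017

end
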